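import Summits.QuantumAdvantage.QuantumAdvantage.Theorems.MobiusLadderLiouvilleNotPPolyOneTimePad
import Summits.QuantumAdvantage.QuantumAdvantage.Theorems.MobiusLadderLiouvilleNotPPolyPadOracle
import Summits.QuantumAdvantage.QuantumAdvantage.Theorems.MobiusLadderLiouvilleNotPPolyMildAvgHardOfApex
import Summits.QuantumAdvantage.QuantumAdvantage.Theorems.MobiusLadderLiouvilleNotPPolySubexpTightness
import Summits.QuantumAdvantage.QuantumAdvantage.Theorems.MobiusLadderLiouvilleNotPPolyMulConstCircuit
import Summits.QuantumAdvantage.QuantumAdvantage.Theorems.MobiusLadderLiouvilleNotPPolyHardcoreInstances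
import Summits.QuantumAdvantage.QuantumAdvantage.Theorems.MobiusLadderLiouvilleNotPPolySelfAmplification
import Summits.QuantumAdvantage.QuantumAdvantage.Theorems.MobiusLadderLiouvilleNotPPolyFactoringAvgHard
import Summits.QuantumAdvantage.QuantumAdvantage.Theorems.MobiusLadderLiouvilleNotPPolyStrength
import Summits.QuantumAdvantage.QuantumAdvantage.Theorems.MobiusLadderLiouvilleNotPPolyDominance
import Literature.Computability.Complexity.HamMatrixCircuits
import Literature.Computability.Complexity.CircuitLowerBounds
import HarnessLib

/-!
# Crux `MobiusLadder.LiouvilleNotPPoly` (stmt-QuantumAdvantage-1389), line `SketchIdeator4`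
# (card `multiplicative-one-time-pad`): the line ASSEMBLED, and the position of its apex `C⁺`

Lead c4. With every earned stub of the line a tree theorem (T1a p126926, T1b p127666, T2a p127564,
T2b p128067, T2c p127711, T3′ p127829, link p126581, kernel p126947, Defs p126095), this file records,
sorry-free:

* **the line's theorem in by-name form**: the apex `C⁺ = LiouvilleOrthogonalPPoly` (Möbius randomness
  at polynomial size) — the ONE remaining registered stub, hypothesis-type — gives the crux
  `Theses.MobiusLadder.LiouvilleNotPPoly` (`liouvilleNotPPoly_of_apex`), as does each `1/poly` level
  `MildAvgHard c` (`liouvilleNotPPoly_of_mildAvgHard`);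
* **T1 assembled**: the crux is EQUIVALENT to the absence of a `P/poly` family with error
  `≤ 2^{ℓ-ℓ^ε}/16` (`crux_iff_noRareError`, `0 < ε ≤ 1`) — `X` is itself a (very mild) average-case
  statement, and a refutation of `X` needs only a rare-error family;
* **T2 assembled**: `MildAvgHard c` ⇒ vanishing correlation with `λ` on Kalai products at polynomial
  size (`selfAmplification`), hence under `C⁺` (`selfAmplification_of_apex`);
* **T3′ under the apex**: `C⁺` ⇒ factoring is `1/n`-hard on average for polynomial-size circuits
  (`factoringAvgHard_of_apex`);
* **DOMINANCE of the apex over the route's OTHER open crux**: `C⁺ ⇒ LiouvilleOrthogonalTC0`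
  (crux stmt-QuantumAdvantage-1393), because a `tcBasis`-circuit with `s` gates on `n` inputs is a
  `B₂`-circuit with `≤ s (gadgetSize (n+s) + 1) = poly` gates computing the same function (tree:
  `HamMatrix.exists_B2_of_tcBasis`, Muroga weights + iterated addition) — so ONE hypothesis `C⁺`
  closes both remaining cruxes of route MobiusLadder (`liouvilleOrthogonalTC0_of_apex`), and with the
  proved glue 1398 gives `L_λ ∉ TC⁰` (`liouville_not_mem_TC0_of_apex`);
* **strength** (`C⁺ ⇒ NP ⊄ P/poly`, `⇒ PneNP`, `⇒ ClbFactNotPpoly`) and the **refutation surface**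
  (`RareErrorFamily ε`, `NP ⊆ P/poly`, `FactInP` each refute `C⁺`).
-/

set_option linter.dupNamespace false -- D-0017: single-problem summit ⇒ `QuantumAdvantage.QuantumAdvantage` by design

noncomputable section

namespace Summit.QuantumAdvantage.QuantumAdvantage.Theorems.LiouvilleNotPPoly.OneTimePad

open Literature.Computability.Complexity
open Literature.Probability.RandomGraphs.LowDegree (sgn sgn_true sgn_false)
open _root_.Computability Filter Finset Polynomial
open Summit.QuantumAdvantage.QuantumAdvantage.Theorems.MobiusLadder
open Summit.QuantumAdvantage.QuantumAdvantage.Theorems.LiouvilleOrthogonalTC0 (bits ofBits lamBit)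

/-! ## The line assembled -/

/-- **The line's theorem, by name.** The apex `C⁺` gives the crux
`Summit.QuantumAdvantage.QuantumAdvantage.Theses.MobiusLadder.LiouvilleNotPPoly`. -/
theorem liouvilleNotPPoly_of_apex (H : LiouvilleOrthogonalPPoly) :
    Theses.MobiusLadder.LiouvilleNotPPoly :=
  liouvilleLang_not_mem_PPoly_of_apex H

/-- **Each `1/poly` level gives the crux, by name**: `MildAvgHard c → LiouvilleNotPPoly`. -/
theorem liouvilleNotPPoly_of_mildAvgHard {c : ℕ} (H : MildAvgHard c) :
    Theses.MobiusLadder.LiouvilleNotPPoly :=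
  liouvilleLang_not_mem_PPoly_of_mildAvgHard H

/-- The ladder is linear: `C⁺ ⇒ MildAvgHard 1 ⇒ X` (link p126581 + Composition 2 p126947). -/
theorem liouvilleNotPPoly_of_apex' (H : LiouvilleOrthogonalPPoly) :
    Theses.MobiusLadder.LiouvilleNotPPoly :=
  liouvilleNotPPoly_of_mildAvgHard (stub_mildAvgHard_of_apex H)

/-- **T1 assembled (T1a p126926 + T1b p127666): subexponential-error tightness** — a `P/poly`
language with error `≤ 2^{ℓ-ℓ^ε}/16` at every large length already puts `L_λ` in `P/poly`. -/
theorem subexpTightness {ε : ℝ} (hε : 0 < ε) (hε1 : ε ≤ 1) (hR : RareErrorFamily ε) :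
    liouvilleLang ∈ PPoly :=
  stub_subexpTightness stub_padOracle ε hε hε1 hR

/-- **Corollary of T1: the crux is EQUIVALENT to the absence of rare-error families** (`0 < ε ≤ 1`):
`X ⟺ ¬ RareErrorFamily ε`. -/
theorem crux_iff_noRareError {ε : ℝ} (hε : 0 < ε) (hε1 : ε ≤ 1) :
    Theses.MobiusLadder.LiouvilleNotPPoly ↔ ¬ RareErrorFamily ε :=
  ⟨fun hX hR => hX (subexpTightness hε hε1 hR), fun hR hmem => hR (rareErrorFamily_of_mem_PPoly hmem ε)⟩

/-- **T2 assembled (T2a p127564 + T2b p128067 + T2c p127711): XOR self-amplification on Kalai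
products** — `MildAvgHard c` forces vanishing correlation of every polynomial-size circuit with `λ`
on products of `k(n) = poly(n)` independent `n`-bit instances. -/
theorem selfAmplification (c : ℕ) (H : MildAvgHard c) (p : Polynomial ℕ) {ε : ℝ} (hε : 0 < ε) :
    ∃ k : ℕ → ℕ, (∃ d : ℕ, ∀ n, k n ≤ n ^ d + d) ∧ (∀ n, 1 ≤ k n) ∧
      ∀ᶠ n : ℕ in atTop, ∀ C : Circuit (Fin (k n * n)), C.IsOver B2 →
        C.size ≤ p.eval (k n * n) → |prodCorr n (k n) C| ≤ ε :=
  stub_selfAmplification stub_mulConstCircuit stub_hardcoreInstances c H p ε hε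

/-- **T2 under the apex**: `C⁺` gives vanishing correlation with `λ` on the Kalai product ensembles
at polynomial size — a conditional Chowla-type statement internal to `λ`. -/
theorem selfAmplification_of_apex (H : LiouvilleOrthogonalPPoly) (p : Polynomial ℕ) {ε : ℝ}
    (hε : 0 < ε) :
    ∃ k : ℕ → ℕ, (∃ d : ℕ, ∀ n, k n ≤ n ^ d + d) ∧ (∀ n, 1 ≤ k n) ∧
      ∀ᶠ n : ℕ in atTop, ∀ C : Circuit (Fin (k n * n)), C.IsOver B2 →
        C.size ≤ p.eval (k n * n) → |prodCorr n (k n) C| ≤ ε :=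
  selfAmplification 1 (stub_mildAvgHard_of_apex H) p hε

/-- **T3′ under the apex (link p126581 + T3′ p127829)**: `C⁺` makes factoring `1/n`-hard on average
for polynomial-size multi-output circuits on uniform `n`-bit integers. -/
theorem factoringAvgHard_of_apex (H : LiouvilleOrthogonalPPoly) (p : Polynomial ℕ) :
    ∀ᶠ n : ℕ in atTop, ∀ F : (Fin n → Bool) → Fin n × Fin n → Bool, CktSize B2 F (p.eval n) →
      (n : ℝ) ^ 1 *
          (((Finset.Ico (2 ^ (n - 1)) (2 ^ n)).filter fun N =>
              ((List.ofFn fun i : Fin n => ofBits fun j : Fin n => F (bits n N) (i, j)).filter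
                  (· ≠ 0)).Perm N.primeFactorsList).card : ℝ) ≤
        ((n : ℝ) ^ 1 - 1) * (2 : ℝ) ^ (n - 1) :=
  stub_factoringAvgHard 1 (stub_mildAvgHard_of_apex H) p

/-! ## Dominance: the apex closes the route's other open crux (1393) as well -/

/-- **`C⁺ ⇒ LiouvilleOrthogonalTC0` (crux stmt-QuantumAdvantage-1393).** A `tcBasis`-circuit with
`s ≤ p(n)` gates on `n` inputs is simulated by a `B₂`-circuit with `≤ s (gadgetSize (n+s) + 1)` gates
(`HamMatrix.exists_B2_of_tcBasis`: Muroga's weight bound and iterated addition; `gadgetSize ≤ g`, a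
polynomial, `HamMatrix.exists_poly_gadgetSize`; `natPoly_eval_mono`), i.e. `≤ P(n)` for `P = p (g ∘ (X + p) + 1)`;
the apex at `P` bounds its correlation, which is the correlation of the original circuit.
[cite: Vollmer1999, §4.5.2, Cor. 4.35] -/
theorem liouvilleOrthogonalTC0_of_apex :
    LiouvilleOrthogonalPPoly → Theses.MobiusLadder.LiouvilleOrthogonalTC0 := by
  intro H d p ε hε
  obtain ⟨g, hg⟩ := HamMatrix.exists_poly_gadgetSize
  have hev := H (p * (g.comp (X + p) + 1)) ε hε
  filter_upwards [hev] with n hn C hCB _hCd hCs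
  obtain ⟨C', hC'B, hC's, hC'e⟩ := HamMatrix.exists_B2_of_tcBasis C hCB
  have hsize : C'.size ≤ (p * (g.comp (X + p) + 1)).eval n := by
    have h1 : HamMatrix.gadgetSize (n + C.size) ≤ g.eval (n + p.eval n) :=
      (hg _).trans (natPoly_eval_mono g (Nat.add_le_add_left hCs n))
    have h2 : C'.size ≤ p.eval n * (g.eval (n + p.eval n) + 1) :=
      hC's.trans (Nat.mul_le_mul hCs (Nat.add_le_add_right h1 1))
    simpa [Polynomial.eval_comp] using h2
  have hb := hn C' hC'B hsize
  unfold corr at hb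
  have heq : ∀ N : ℕ, C'.eval (bits n N) = C.eval (fun i : Fin n => Nat.testBit N i) :=
    fun N => hC'e (bits n N)
  simpa only [heq] using hb

/-- **`C⁺ ⇒ L_λ ∉ TC⁰`**, through crux 1393 and the proved glue `LiouvilleNotTC0` (item 1398). -/
theorem liouville_not_mem_TC0_of_apex (H : LiouvilleOrthogonalPPoly) :
    encodingNatBool.toLanguage {N : ℕ | ArithmeticFunction.liouville N = -1} ∉ TC0 :=
  LiouvilleNotTC0_proof (liouvilleOrthogonalTC0_of_apex H)

/-! ## Strength of the apex -/

/-- **`C⁺ ⇒ NP ⊄ P/poly`** (through `X`; Strength p117096: `L_λ ∈ NP ∩ coNP`). -/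
theorem NP_not_subset_PPoly_of_apex (H : LiouvilleOrthogonalPPoly) :
    ¬ Nondeterministic.NP ⊆ PPoly :=
  NP_not_subset_PPoly_of_liouvilleNotPPoly (liouvilleNotPPoly_of_apex H)

/-- **`C⁺ ⇒ PneNP`** (the hub's `P ≠ NP` summit, with `L_λ` as Cook's witness; Strength p117096). -/
theorem pneNP_of_apex (H : LiouvilleOrthogonalPPoly) : PneNP :=
  pneNP_of_liouvilleNotPPoly (liouvilleNotPPoly_of_apex H)

/-- **`C⁺ ⇒ ClbFactNotPpoly`** (the closed route CircuitLB's hypothesis `FACT ∉ P/poly`; Dominance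
p118636). -/
theorem clbFactNotPpoly_of_apex (H : LiouvilleOrthogonalPPoly) :
    Summit.QuantumAdvantage.QuantumAdvantage.Theses.CircuitLB.ClbFactNotPpoly :=
  clbFactNotPpoly_of_liouvilleNotPPoly (liouvilleNotPPoly_of_apex H)

/-! ## Refutation surface of the apex -/

/-- A rare-error family (error `≤ 2^{ℓ-ℓ^ε}/16`, `0 < ε ≤ 1`) refutes `C⁺` (T1 + the composition). -/
theorem not_apex_of_rareErrorFamily {ε : ℝ} (hε : 0 < ε) (hε1 : ε ≤ 1) (hR : RareErrorFamily ε) :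
    ¬ LiouvilleOrthogonalPPoly :=
  fun H => liouvilleLang_not_mem_PPoly_of_apex H (subexpTightness hε hε1 hR)

/-- `NP ⊆ P/poly` refutes `C⁺`. -/
theorem not_apex_of_NP_subset_PPoly (hsub : Nondeterministic.NP ⊆ PPoly) :
    ¬ LiouvilleOrthogonalPPoly :=
  fun H => NP_not_subset_PPoly_of_apex H hsub

/-- Polynomial-time factoring (`FactInP`) refutes `C⁺` (Dominance p118636). -/
theorem not_apex_of_factInP (hF : Literature.Computability.QuantumComplexity.FactInP) :
    ¬ LiouvilleOrthogonalPPoly :=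
  fun H => not_factInP_of_liouvilleNotPPoly (liouvilleNotPPoly_of_apex H) hF

end Summit.QuantumAdvantage.QuantumAdvantage.Theorems.LiouvilleNotPPoly.OneTimePad

end
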